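import Summits.CriticalPhenomena.PercolationContinuityZ3.Theorems.SahiMasterFamilyPhiAffine
import Summits.CriticalPhenomena.PercolationContinuityZ3.Theorems.SahiMasterFamilyPatchSingle
import Summits.CriticalPhenomena.PercolationContinuityZ3.Theorems.SahiMasterFamilyPhiMinClosed
import Summits.CriticalPhenomena.PercolationContinuityZ3.Theorems.SahiMasterFamilyEdgeOne

/-!
# `(UC-hull)` on every edge `[1_𝒰, 1_𝒱]` such that the members of `𝒰 ∖ 𝒱` have a COMMON ELEMENT, every order
# (`𝒱 ⊇ 𝒰 ∩ 𝒱` arbitrary union-closed): one affine step + chain term + FREE-INDEX term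

Unit `prim-masterthm-p4` (gen 21; crux anchor stmt-CriticalPhenomena-4575, helper work; memo
`run/shared/lean/prim/prim-masterthm/prim-masterthm-p4/P4-GEN21-REPORT.md` §3c).  Companion of `…PhiAffine` (Φ affine along intersecting-supported directions),
`…PhiMinClosed` (chain mixtures are `≥ 0`), `…PhiFreeIndex` (one free index); generalises `…EdgeOne` (`|𝒰 ∖ 𝒱| = 1`), whose two lemmas (free index over a min-closed function; chain mixtures are min-closed) it reuses.

**THEOREM (every order)** `ucHull_edge_star`.  Let `𝒰, 𝒱 ∋ univ` be union-closed and suppose some element `z` lies in EVERY member of `𝒰 ∖ 𝒱` (e.g. `|𝒰 ∖ 𝒱| = 1`,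
or `𝒰 ∖ 𝒱 ⊆ {S : z ∈ S}`).  Then `Φ_{k+1}(w·1_𝒰 + (1−w)·1_𝒱) ≥ 0` for all `w ∈ [0,1]`.  PROOF: the direction `1_{𝒰∖𝒱}` is supported on a pairwise-intersecting family,
so Φ is affine along it and the edge point `c + w·1_{𝒰∖𝒱}` (`c = w1_{𝒰∩𝒱} + (1−w)1_𝒱`, the chain mixture, min-closed) has `Φ = (1−w)Φ(c) + wΦ(c + 1_{𝒰∖𝒱})`; the point
`γ = c + 1_{𝒰∖𝒱}` is not min-closed in general but AGREES WITH `c` OFF `z`, hence is Sahi-nonnegative by the free index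
(`EdgeOne.phiSet_nonneg_free_over_minClosed`).  HONEST FRAMING: (B), `UCHullNonneg k` (k ≥ 8), Sahi's `C_k` and the master theorem remain OPEN.  Axioms standard. [this work]
-/

noncomputable section

open scoped Classical

namespace Summit.CriticalPhenomena.PercolationContinuityZ3.Theorems

namespace EdgeStar

open Finset Function
open Literature.Combinatorics.Sahi2008
open PrincipalCapBeta (phiSet)

variable {k : ℕ}

/-- **`(UC-hull)` on every edge whose `𝒰 ∖ 𝒱` has a common element, every order.**  `𝒰, 𝒱 ∋ univ` union-closed, `z ∈ S` for every `S ∈ 𝒰 ∖ 𝒱`: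
then `Φ(w·1_𝒰 + (1−w)·1_𝒱) ≥ 0` for `w ∈ [0,1]`. [this work] -/
theorem ucHull_edge_star (𝒰 𝒱 : Finset (Finset (Fin (k + 1))))
    (hU : ∀ S ∈ 𝒰, ∀ S' ∈ 𝒰, S ∪ S' ∈ 𝒰) (hV : ∀ S ∈ 𝒱, ∀ S' ∈ 𝒱, S ∪ S' ∈ 𝒱) (hUt : univ ∈ 𝒰) (hVt : univ ∈ 𝒱)
    (z : Fin (k + 1)) (hz : ∀ S ∈ 𝒰, S ∉ 𝒱 → z ∈ S) {w : ℝ} (hw0 : 0 ≤ w) (hw1 : w ≤ 1) :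
    0 ≤ phiSet (k + 1) (fun S => w * (if S ∈ 𝒰 then (1 : ℝ) else 0) + (1 - w) * (if S ∈ 𝒱 then (1 : ℝ) else 0)) := by
  have h1w : 0 ≤ 1 - w := sub_nonneg.2 hw1
  set 𝒲 := 𝒰 ∩ 𝒱 with h𝒲
  have hW : ∀ S ∈ 𝒲, ∀ S' ∈ 𝒲, S ∪ S' ∈ 𝒲 := fun S hS S' hS' =>
    mem_inter.2 ⟨hU _ (mem_inter.1 hS).1 _ (mem_inter.1 hS').1, hV _ (mem_inter.1 hS).2 _ (mem_inter.1 hS').2⟩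
  have hWV : ∀ S ∈ 𝒲, S ∈ 𝒱 := fun S hS => (mem_inter.1 hS).2
  -- chain point `c` and the shifted point `γ = c + 1_{𝒰 ∖ 𝒱}`
  set c : Finset (Fin (k + 1)) → ℝ := fun S => w * (if S ∈ 𝒲 then (1 : ℝ) else 0) + (1 - w) * (if S ∈ 𝒱 then (1 : ℝ) else 0) with hc
  set γ : Finset (Fin (k + 1)) → ℝ := fun S => c S + (if S ∈ 𝒰 ∧ S ∉ 𝒱 then (1 : ℝ) else 0) with hγ
  have hedge : (fun S => w * (if S ∈ 𝒰 then (1 : ℝ) else 0) + (1 - w) * (if S ∈ 𝒱 then (1 : ℝ) else 0)) =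
      fun S => (1 - w) * c S + w * γ S := by
    funext S
    simp only [hγ, hc]
    by_cases hSU : S ∈ 𝒰
    · by_cases hSV : S ∈ 𝒱
      · rw [if_pos hSU, if_pos hSV, if_pos (mem_inter.2 ⟨hSU, hSV⟩), if_neg (fun h : S ∈ 𝒰 ∧ S ∉ 𝒱 => h.2 hSV)]; ring
      · rw [if_pos hSU, if_neg hSV, if_neg (fun h => hSV (mem_inter.1 h).2), if_pos ⟨hSU, hSV⟩]; ring
    · rw [if_neg hSU, if_neg (fun h => hSU (mem_inter.1 h).1), if_neg (fun h : S ∈ 𝒰 ∧ S ∉ 𝒱 => hSU h.1)]; ring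
  rw [hedge, PhiAffine.phiSet_lineMap_of_inter c γ (fun S T hST => ?_) w]
  · have c0 : ∀ S, 0 ≤ c S := fun S => by simp only [hc]; split_ifs <;> nlinarith
    have c1 : ∀ S, c S ≤ 1 := fun S => by simp only [hc]; split_ifs <;> nlinarith
    have cmin : ∀ S T, min (c S) (c T) ≤ c (S ∪ T) := fun S T => EdgeOne.minClosed_chain 𝒲 𝒱 hW hV hWV hw0 hw1 S T
    have hcnn : 0 ≤ phiSet (k + 1) c := PhiMinClosed.phiSet_nonneg_of_minClosed c c0 c1 cmin
    have hc0' : ∀ S, S ∈ 𝒰 → S ∉ 𝒱 → c S = 0 := fun S hSU hSV => by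
      simp only [hc]; rw [if_neg (fun h => hSV (mem_inter.1 h).2), if_neg hSV]; ring
    have g0 : ∀ S, 0 ≤ γ S := fun S => by simp only [hγ]; have := c0 S; split_ifs <;> linarith
    have g1 : ∀ S, γ S ≤ 1 := fun S => by
      by_cases h : S ∈ 𝒰 ∧ S ∉ 𝒱
      · have e : γ S = c S + 1 := by simp only [hγ]; rw [if_pos h]
        rw [e, hc0' S h.1 h.2]; norm_num
      · have e : γ S = c S := by simp only [hγ]; rw [if_neg h, add_zero]
        rw [e]; exact c1 S
    have guniv : γ univ = 1 := by
      simp only [hγ, hc]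
      rw [if_neg (fun h : (univ : Finset (Fin (k + 1))) ∈ 𝒰 ∧ univ ∉ 𝒱 => h.2 hVt), if_pos (mem_inter.2 ⟨hUt, hVt⟩), if_pos hVt]; ring
    have hγnn : 0 ≤ phiSet (k + 1) γ := EdgeOne.phiSet_nonneg_free_over_minClosed γ c g0 g1 guniv cmin z
      (fun S hzS => by
        have h : ¬ (S ∈ 𝒰 ∧ S ∉ 𝒱) := fun h' => hzS (hz S h'.1 h'.2)
        simp only [hγ]; rw [if_neg h, add_zero])
    exact add_nonneg (mul_nonneg h1w hcnn) (mul_nonneg hw0 hγnn)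
  · -- the direction `γ − c = 1_{𝒰 ∖ 𝒱}` is supported on a family of sets all containing `z`
    simp only [hγ]
    by_cases hS : S ∈ 𝒰 ∧ S ∉ 𝒱
    · by_cases hT : T ∈ 𝒰 ∧ T ∉ 𝒱
      · exact absurd (disjoint_left.1 hST (hz S hS.1 hS.2)) (not_not.2 (hz T hT.1 hT.2))
      · rw [if_neg hT]; ring
    · rw [if_neg hS]; ring

/-- The mirror statement: the members of `𝒱 ∖ 𝒰` have a common element. [this work] -/
theorem ucHull_edge_star' (𝒰 𝒱 : Finset (Finset (Fin (k + 1))))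
    (hU : ∀ S ∈ 𝒰, ∀ S' ∈ 𝒰, S ∪ S' ∈ 𝒰) (hV : ∀ S ∈ 𝒱, ∀ S' ∈ 𝒱, S ∪ S' ∈ 𝒱) (hUt : univ ∈ 𝒰) (hVt : univ ∈ 𝒱)
    (z : Fin (k + 1)) (hz : ∀ S ∈ 𝒱, S ∉ 𝒰 → z ∈ S) {w : ℝ} (hw0 : 0 ≤ w) (hw1 : w ≤ 1) :
    0 ≤ phiSet (k + 1) (fun S => w * (if S ∈ 𝒰 then (1 : ℝ) else 0) + (1 - w) * (if S ∈ 𝒱 then (1 : ℝ) else 0)) := by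
  have h := ucHull_edge_star 𝒱 𝒰 hV hU hVt hUt z hz (sub_nonneg.2 hw1) (by linarith : 1 - w ≤ 1)
  have e : (fun S => (1 - w) * (if S ∈ 𝒱 then (1 : ℝ) else 0) + (1 - (1 - w)) * (if S ∈ 𝒰 then (1 : ℝ) else 0)) =
      fun S => w * (if S ∈ 𝒰 then (1 : ℝ) else 0) + (1 - w) * (if S ∈ 𝒱 then (1 : ℝ) else 0) := by
    funext S; ring
  rw [e] at h
  exact h

end EdgeStar

end Summit.CriticalPhenomena.PercolationContinuityZ3.Theorems
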